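import Summits.NavierStokesRegularity.NavierStokesRegularity.Theorems.EfficiencyFloorNearSaturationNearMaximiserShape
import Summits.NavierStokesRegularity.NavierStokesRegularity.Theorems.EfficiencyFloorNearSaturationNearMaximiserSeqCoreTransport
import HarnessLib

/-!
# Route `EfficiencyFloor`, crux `NearSaturationNearMaximiser` (stmt-NavierStokesRegularity-25482): the SEQUENTIAL CORE —
# the item follows from «normalised near-maximising sequences are asymptotically `Ḣ¹ ∩ Ḣ²`-close to exact normalised maximisers»

Helper file (`--supports stmt-NavierStokesRegularity-25482`; sequel to `…NearSaturationNearMaximiserShape`, which proved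
`NearSaturationNearMaximiser ⟺ SHAPE`). SHAPE quantifies `∀ ε ∃ δ ∀ ν ∀ v` over admissible fields of arbitrary enstrophy `Z`,
palinstrophy `Pal` and viscosity `ν`; its open content is a concentration-compactness statement for the scale-invariant
Lu–Doering efficiency `S/(Z^{3/4}Pal^{3/4})` on `ℝ³`. This file strips the bookkeeping and leaves exactly the sequential
statement a concentration-compactness argument produces:

* SEQUENTIAL CORE at `c` (hypothesis `H`, def-free): every sequence `v_n` of admissible fields NORMALISED to
  `Z(v_n) = Pal(v_n) = 1` with `S(v_n) → c` has, for every `ε > 0`, a term `v_n` and an admissible `m` with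
  `Z(m) = Pal(m) = 1`, `S(m) = c` such that `Z(v_n − m) ≤ ε²`, `Pal(v_n − m) ≤ ε²` (only ONE term is asked for — apply it to
  tails for the «eventually» form).
* `shape_of_seqCore` — one-sided admissibility of `c` + the sequential core at `c` ⟹ SHAPE at `c`, every `ε > 0`.
  PROOF: if SHAPE fails at `ε`, pick bad fields `v_n` at levels `δ_n = η/(n+1)`, `η = min(ε/2, 1/2)`; with `A = Z^{1/4}`,
  `B = Pal^{1/4}` the Navier–Stokes scaling `l = A²/B²` composed with the amplitude `b = B/A³` gives `Z = Pal = 1` and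
  `S ∈ [(1−δ_n)c, c]` (`SeqCore.normalise`, p840771; tools p840717), so the core applies; the field `m` it returns is a
  normalised maximiser at `ν = 3c/4`; the ratio window says the normalisation required for `v_n` differs by the amplitude
  factor `r = b/κ` with `|r − 1| ≤ δ_n ≤ ε/2` (`κ = 3c/(4ν_n)`), so `r • m` is still `ε`-close (`SeqCore.close_of_amplitude`);
  pulling `r • m` back by the inverse transport gives a normalised maximiser at `ν_n` (`normalisedMaximiser_const_smul`,
  `normalisedMaximiser_scale`) that is scale-free `ε`-close to `v_n` (`SeqCore.transport_close`) — contradiction.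
* `nearSaturationNearMaximiser_of_seqCore` — BY NAME: the sequential core at the sharp constant ⟹
  `Theses.EfficiencyFloor.NearSaturationNearMaximiser`.

READING. With `…SeqCoreStretching` (p840779) and `…SeqCoreContinuity` (`Z, Pal, S` pass to `Ḣ¹ ∩ Ḣ²` limits of normalised
admissible sequences), the open content of stmt-25482 is now literally: PRECOMPACTNESS in `Ḣ¹ ∩ Ḣ²` MODULO TRANSLATIONS of
normalised maximising sequences of the Lu–Doering functional (vanishing excluded by the landed `EfficiencyConcentration`
stmt-23111, dichotomy penalised by `…NearSaturationNearMaximiserDichotomy`). HONEST FRAMING: a reduction between OPEN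
statements; the sequential core is a HYPOTHESIS, not proved; stmt-25482, `LerayFloorGap`, `ProductionEfficiencyDecay`
(stmt-22866) and Navier–Stokes regularity stay OPEN; no summit statement is proved. [folklore]
-/

-- the problem directory repeats the summit name (`NavierStokesRegularity/NavierStokesRegularity`)
set_option linter.dupNamespace false

noncomputable section

namespace Summit.NavierStokesRegularity.NavierStokesRegularity.Theorems

namespace NearSaturationNearMaximiser

namespace SeqCore

open Set MeasureTheory Filter Topology Function
open scoped InnerProductSpace ENNReal
open Literature.Analysis.FluidPDE
open MaximiserSetRigidity.OrbitInvariance RigidExit.Resonance LerayFloorGap.Attainment RigidExit.ReferenceShadowing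

/-! ## §4 The sequential core implies SHAPE stability, hence the item -/

/-- **SHAPE stability from the sequential core.** Let `c > 0` be one-sided admissible (`S ≤ c Z^{3/4} Pal^{3/4}` on
admissible fields) and assume the SEQUENTIAL CORE at `c`: every sequence of admissible fields normalised to `Z = Pal = 1`
whose stretching tends to `c` has a term `ε`-close in `Ḣ¹ ∩ Ḣ²` to an admissible field with `Z = Pal = 1`, `S = c`, for every
`ε > 0`. Then the SHAPE statement of `nearSaturationNearMaximiser_iff_shape` holds at `c` for every `ε > 0`: uniformly in the
viscosity, near-maximal efficiency plus the quarter-power ratio window force scale-free `Ḣ¹ ∩ Ḣ²`-closeness to a normalised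
maximiser. Proof: contradiction, Navier–Stokes + amplitude scaling of a bad sequence to `Z = Pal = 1`, transport back. [folklore] -/
theorem shape_of_seqCore {c : ℝ} (hc : 0 < c)
    (hadm : ∀ v : EuclideanSpace ℝ (Fin 3) → EuclideanSpace ℝ (Fin 3), (ContDiff ℝ (⊤ : ℕ∞) v ∧
      Literature.Analysis.FluidPDE.VectorCalculus.IsDivFree v ∧ (∫⁻ x, ‖iteratedFDeriv ℝ 0 v x‖ₑ ^ 2 < ⊤) ∧
      (∫⁻ x, ‖iteratedFDeriv ℝ 1 v x‖ₑ ^ 2 < ⊤) ∧ (∫⁻ x, ‖iteratedFDeriv ℝ 2 v x‖ₑ ^ 2 < ⊤)) → (∫ x,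
      ⟪Literature.Analysis.FluidPDE.curl v x, fderiv ℝ v x (Literature.Analysis.FluidPDE.curl v x)⟫_ℝ) ≤ c *
      (∫ x, ‖Literature.Analysis.FluidPDE.curl v x‖ ^ 2) ^ (3 / 4 : ℝ) * (∫ x,
      Literature.Analysis.FluidPDE.frobeniusNormSq (fderiv ℝ (Literature.Analysis.FluidPDE.curl v) x)) ^ (3 / 4 : ℝ))
    (H : ∀ v : ℕ → EuclideanSpace ℝ (Fin 3) → EuclideanSpace ℝ (Fin 3), (∀ n, ContDiff ℝ (⊤ : ℕ∞) (v n) ∧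
      Literature.Analysis.FluidPDE.VectorCalculus.IsDivFree (v n) ∧ (∫⁻ x, ‖iteratedFDeriv ℝ 0 (v n) x‖ₑ ^ 2 < ⊤) ∧
      (∫⁻ x, ‖iteratedFDeriv ℝ 1 (v n) x‖ₑ ^ 2 < ⊤) ∧ (∫⁻ x, ‖iteratedFDeriv ℝ 2 (v n) x‖ₑ ^ 2 < ⊤)) →
      (∀ n, (∫ x, ‖Literature.Analysis.FluidPDE.curl (v n) x‖ ^ 2) = 1) →
      (∀ n, (∫ x, Literature.Analysis.FluidPDE.frobeniusNormSq (fderiv ℝ (Literature.Analysis.FluidPDE.curl (v n)) x)) = 1) →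
      Tendsto (fun n => ∫ x, ⟪Literature.Analysis.FluidPDE.curl (v n) x, fderiv ℝ (v n) x
        (Literature.Analysis.FluidPDE.curl (v n) x)⟫_ℝ) atTop (𝓝 c) →
      ∀ ε : ℝ, 0 < ε → ∃ n : ℕ, ∃ m : EuclideanSpace ℝ (Fin 3) → EuclideanSpace ℝ (Fin 3), (ContDiff ℝ (⊤ : ℕ∞) m ∧
        Literature.Analysis.FluidPDE.VectorCalculus.IsDivFree m ∧ (∫⁻ x, ‖iteratedFDeriv ℝ 0 m x‖ₑ ^ 2 < ⊤) ∧
        (∫⁻ x, ‖iteratedFDeriv ℝ 1 m x‖ₑ ^ 2 < ⊤) ∧ (∫⁻ x, ‖iteratedFDeriv ℝ 2 m x‖ₑ ^ 2 < ⊤)) ∧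
        (∫ x, ‖Literature.Analysis.FluidPDE.curl m x‖ ^ 2) = 1 ∧
        (∫ x, Literature.Analysis.FluidPDE.frobeniusNormSq (fderiv ℝ (Literature.Analysis.FluidPDE.curl m) x)) = 1 ∧
        (∫ x, ⟪Literature.Analysis.FluidPDE.curl m x, fderiv ℝ m x (Literature.Analysis.FluidPDE.curl m x)⟫_ℝ) = c ∧
        (∫ x, ‖Literature.Analysis.FluidPDE.curl (v n - m) x‖ ^ 2) ≤ ε ^ 2 ∧
        (∫ x, Literature.Analysis.FluidPDE.frobeniusNormSq (fderiv ℝ (Literature.Analysis.FluidPDE.curl (v n - m)) x)) ≤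
          ε ^ 2)
    {ε : ℝ} (hε : 0 < ε) :
    ∃ δ : ℝ, 0 < δ ∧ ∀ ν : ℝ, 0 < ν → ∀ v : EuclideanSpace ℝ (Fin 3) →
      EuclideanSpace ℝ (Fin 3), (ContDiff ℝ (⊤ : ℕ∞) v ∧ Literature.Analysis.FluidPDE.VectorCalculus.IsDivFree
      v ∧ (∫⁻ x, ‖iteratedFDeriv ℝ 0 v x‖ₑ ^ 2 < ⊤) ∧ (∫⁻ x, ‖iteratedFDeriv ℝ 1 v x‖ₑ ^ 2 < ⊤) ∧ (∫⁻ x,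
      ‖iteratedFDeriv ℝ 2 v x‖ₑ ^ 2 < ⊤)) → 0 < (∫ x, ‖Literature.Analysis.FluidPDE.curl v x‖ ^ 2) → (1 - δ) *
      (c * (∫ x, ‖Literature.Analysis.FluidPDE.curl v x‖ ^ 2) ^ (3 / 4 : ℝ) * (∫ x,
      Literature.Analysis.FluidPDE.frobeniusNormSq (fderiv ℝ (Literature.Analysis.FluidPDE.curl v) x)) ^ (3 /
      4 : ℝ)) ≤ (∫ x, ⟪Literature.Analysis.FluidPDE.curl v x, fderiv ℝ v x (Literature.Analysis.FluidPDE.curl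
      v x)⟫_ℝ) → |(∫ x, Literature.Analysis.FluidPDE.frobeniusNormSq (fderiv ℝ
      (Literature.Analysis.FluidPDE.curl v) x)) ^ (1 / 4 : ℝ) - 3 * c / (4 * ν) * (∫ x,
      ‖Literature.Analysis.FluidPDE.curl v x‖ ^ 2) ^ (3 / 4 : ℝ)| ≤ δ * (3 * c / (4 * ν) * (∫ x,
      ‖Literature.Analysis.FluidPDE.curl v x‖ ^ 2) ^ (3 / 4 : ℝ)) → ∃ m : EuclideanSpace ℝ (Fin 3) →
      EuclideanSpace ℝ (Fin 3), ((ContDiff ℝ (⊤ : ℕ∞) m ∧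
      Literature.Analysis.FluidPDE.VectorCalculus.IsDivFree m ∧ (∫⁻ x, ‖iteratedFDeriv ℝ 0 m x‖ₑ ^ 2 < ⊤) ∧
      (∫⁻ x, ‖iteratedFDeriv ℝ 1 m x‖ₑ ^ 2 < ⊤) ∧ (∫⁻ x, ‖iteratedFDeriv ℝ 2 m x‖ₑ ^ 2 < ⊤)) ∧ 0 < (∫ x,
      ‖Literature.Analysis.FluidPDE.curl m x‖ ^ 2) ∧ (∫ x, ⟪Literature.Analysis.FluidPDE.curl m x, fderiv ℝ m
      x (Literature.Analysis.FluidPDE.curl m x)⟫_ℝ) = c * (∫ x, ‖Literature.Analysis.FluidPDE.curl m x‖ ^ 2) ^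
      (3 / 4 : ℝ) * (∫ x, Literature.Analysis.FluidPDE.frobeniusNormSq (fderiv ℝ
      (Literature.Analysis.FluidPDE.curl m) x)) ^ (3 / 4 : ℝ) ∧ (∫ x,
      Literature.Analysis.FluidPDE.frobeniusNormSq (fderiv ℝ (Literature.Analysis.FluidPDE.curl m) x)) = 81 *
      c ^ 4 / (256 * ν ^ 4) * (∫ x, ‖Literature.Analysis.FluidPDE.curl m x‖ ^ 2) ^ 3) ∧ ((∫ x,
      ‖Literature.Analysis.FluidPDE.curl (v - m) x‖ ^ 2) ≤ ε ^ 2 * (∫ x, ‖Literature.Analysis.FluidPDE.curl v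
      x‖ ^ 2) ∧ (∫ x, Literature.Analysis.FluidPDE.frobeniusNormSq (fderiv ℝ
      (Literature.Analysis.FluidPDE.curl (v - m)) x)) ≤ ε ^ 2 * (∫ x,
      Literature.Analysis.FluidPDE.frobeniusNormSq (fderiv ℝ (Literature.Analysis.FluidPDE.curl v) x))) := by
  by_contra hcon
  push Not at hcon
  -- the sequence of levels `δ_n = η/(n+1) → 0`, `δ_n ≤ η ≤ min(ε/2, 1/2)`
  set η : ℝ := min (ε / 2) (1 / 2) with hη
  have hηpos : 0 < η := lt_min (by positivity) (by norm_num)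
  have hηε : η ≤ ε / 2 := min_le_left _ _
  have hη1 : η ≤ 1 / 2 := min_le_right _ _
  set δ : ℕ → ℝ := fun n => η / ((n : ℝ) + 1) with hδ
  have hδpos : ∀ n, 0 < δ n := fun n => by positivity
  have hδle : ∀ n, δ n ≤ η := fun n => by
    show η / ((n : ℝ) + 1) ≤ η
    exact div_le_self hηpos.le (by linarith [(Nat.cast_nonneg n : (0 : ℝ) ≤ n)])
  have hδ1 : ∀ n, δ n < 1 := fun n => by linarith [hδle n]
  have hδε : ∀ n, δ n ≤ ε / 2 := fun n => (hδle n).trans hηε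
  have hδlim : Tendsto δ atTop (𝓝 0) := by
    have h := (tendsto_one_div_add_atTop_nhds_zero_nat).const_mul η
    rw [mul_zero] at h
    refine h.congr fun n => ?_
    show η * (1 / ((n : ℝ) + 1)) = η / ((n : ℝ) + 1)
    ring
  -- the bad sequence
  choose ν hν v hAdm hZpos heff hwin hbad using fun n => hcon (δ n) (hδpos n)
  -- quarter powers `A = Z^{1/4}`, `B = Pal^{1/4}`
  have hP0 : ∀ n, 0 ≤ ∫ x, frobeniusNormSq (fderiv ℝ (curl (v n)) x) := fun n =>
    integral_nonneg fun x => frobeniusNormSq_nonneg _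
  set A : ℕ → ℝ := fun n => (∫ x, ‖curl (v n) x‖ ^ 2) ^ (1 / 4 : ℝ) with hA
  set B : ℕ → ℝ := fun n => (∫ x, frobeniusNormSq (fderiv ℝ (curl (v n)) x)) ^ (1 / 4 : ℝ) with hB
  have hApos : ∀ n, 0 < A n := fun n => Real.rpow_pos_of_pos (hZpos n) _
  have hA4 : ∀ n, (A n) ^ 4 = ∫ x, ‖curl (v n) x‖ ^ 2 := fun n => (rpow_quarter_pow (hZpos n).le).1
  have hA3 : ∀ n, (∫ x, ‖curl (v n) x‖ ^ 2) ^ (3 / 4 : ℝ) = (A n) ^ 3 := fun n => (rpow_quarter_pow (hZpos n).le).2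
  have hB4 : ∀ n, (B n) ^ 4 = ∫ x, frobeniusNormSq (fderiv ℝ (curl (v n)) x) := fun n => (rpow_quarter_pow (hP0 n)).1
  have hB3 : ∀ n, (∫ x, frobeniusNormSq (fderiv ℝ (curl (v n)) x)) ^ (3 / 4 : ℝ) = (B n) ^ 3 := fun n =>
    (rpow_quarter_pow (hP0 n)).2
  set κ : ℕ → ℝ := fun n => 3 * c / (4 * ν n) with hκ
  have hκpos : ∀ n, 0 < κ n := fun n => by
    show 0 < 3 * c / (4 * ν n)
    have := hν n
    positivity
  have hwin' : ∀ n, |B n - κ n * (A n) ^ 3| ≤ δ n * (κ n * (A n) ^ 3) := fun n => by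
    have h := hwin n
    rw [hA3 n] at h
    exact h
  have hBpos : ∀ n, 0 < B n := fun n => by
    have hB0 : 0 ≤ B n := Real.rpow_nonneg (hP0 n) _
    rcases hB0.lt_or_eq with h | h
    · exact h
    · exfalso
      have hw := hwin' n
      have hk : 0 < κ n * A n ^ 3 := mul_pos (hκpos n) (pow_pos (hApos n) 3)
      rw [← h, zero_sub, abs_neg, abs_of_pos hk] at hw
      have h2 : κ n * A n ^ 3 * 1 ≤ κ n * A n ^ 3 * δ n := by linarith
      have h1 : (1 : ℝ) ≤ δ n := le_of_mul_le_mul_left h2 hk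
      linarith [hδ1 n]
  -- the normalised sequence `v' n = T_{l,b}(v n)`, `l = A²/B²`, `b = B/A³`
  have hlpos : ∀ n, 0 < A n ^ 2 / B n ^ 2 := fun n => div_pos (pow_pos (hApos n) 2) (pow_pos (hBpos n) 2)
  have hbpos : ∀ n, 0 < B n / A n ^ 3 := fun n => div_pos (hBpos n) (pow_pos (hApos n) 3)
  set v' : ℕ → EuclideanSpace ℝ (Fin 3) → EuclideanSpace ℝ (Fin 3) :=
    fun n x => (A n ^ 2 / B n ^ 2) • ((B n / A n ^ 3) • v n ((A n ^ 2 / B n ^ 2) • x)) with hv'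
  have hAdm' : ∀ n, ContDiff ℝ (⊤ : ℕ∞) (v' n) ∧ VectorCalculus.IsDivFree (v' n) ∧
      (∫⁻ x, ‖iteratedFDeriv ℝ 0 (v' n) x‖ₑ ^ 2 < ⊤) ∧ (∫⁻ x, ‖iteratedFDeriv ℝ 1 (v' n) x‖ₑ ^ 2 < ⊤) ∧
      (∫⁻ x, ‖iteratedFDeriv ℝ 2 (v' n) x‖ₑ ^ 2 < ⊤) := fun n => admissible_transport (hAdm n) (hlpos n) (B n / A n ^ 3)
  have hnorm : ∀ n, (∫ x, ‖curl (v' n) x‖ ^ 2) = 1 ∧ (∫ x, frobeniusNormSq (fderiv ℝ (curl (v' n)) x)) = 1 ∧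
      (∫ x, ⟪curl (v' n) x, fderiv ℝ (v' n) x (curl (v' n) x)⟫_ℝ) =
        (∫ x, ⟪curl (v n) x, fderiv ℝ (v n) x (curl (v n) x)⟫_ℝ) / (A n ^ 3 * B n ^ 3) := fun n =>
    normalise (hAdm n) (hApos n) (hBpos n) (hA4 n) (hB4 n)
  have hZ' : ∀ n, (∫ x, ‖curl (v' n) x‖ ^ 2) = 1 := fun n => (hnorm n).1
  have hP' : ∀ n, (∫ x, frobeniusNormSq (fderiv ℝ (curl (v' n)) x)) = 1 := fun n => (hnorm n).2.1
  -- efficiency of the normalised sequence: `(1 − δ_n)c ≤ S ≤ c`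
  have hSup : ∀ n, (∫ x, ⟪curl (v' n) x, fderiv ℝ (v' n) x (curl (v' n) x)⟫_ℝ) ≤ c := fun n => by
    have h := hadm (v' n) (hAdm' n)
    rw [hZ' n, hP' n, Real.one_rpow, mul_one, mul_one] at h
    exact h
  have hSlow : ∀ n, (1 - δ n) * c ≤ (∫ x, ⟪curl (v' n) x, fderiv ℝ (v' n) x (curl (v' n) x)⟫_ℝ) := fun n => by
    have h := heff n
    rw [hA3 n, hB3 n] at h
    rw [(hnorm n).2.2, le_div_iff₀ (mul_pos (pow_pos (hApos n) 3) (pow_pos (hBpos n) 3))]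
    calc (1 - δ n) * c * (A n ^ 3 * B n ^ 3) = (1 - δ n) * (c * A n ^ 3 * B n ^ 3) := by ring
      _ ≤ _ := h
  have hSlim : Tendsto (fun n => ∫ x, ⟪curl (v' n) x, fderiv ℝ (v' n) x (curl (v' n) x)⟫_ℝ) atTop (𝓝 c) := by
    have hlow : Tendsto (fun n => (1 - δ n) * c) atTop (𝓝 c) := by
      have h := ((tendsto_const_nhds (x := (1 : ℝ))).sub hδlim).mul_const c
      rw [sub_zero, one_mul] at h
      exact h
    exact tendsto_of_tendsto_of_tendsto_of_le_of_le hlow tendsto_const_nhds hSlow hSup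
  -- the sequential core gives a normalised limit field close to some term
  obtain ⟨n, m, hmAdm, hZm, hPm, hSm, hZc, hPc⟩ := H v' hAdm' hZ' hP' hSlim (ε / 2) (by positivity)
  -- the amplitude correction `r = b_n / κ_n`, `|r − 1| ≤ δ_n` by the window
  set r : ℝ := (B n / A n ^ 3) / κ n with hr
  have hrpos : 0 < r := div_pos (hbpos n) (hκpos n)
  have hr1 : |r - 1| ≤ δ n := by
    have hk : 0 < κ n * A n ^ 3 := mul_pos (hκpos n) (pow_pos (hApos n) 3)
    have hk0 : κ n ≠ 0 := (hκpos n).ne'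
    have hA0 : A n ≠ 0 := (hApos n).ne'
    have hre : r - 1 = (B n - κ n * A n ^ 3) / (κ n * A n ^ 3) := by
      rw [eq_div_iff hk.ne', hr]
      field_simp
    rw [hre, abs_div, abs_of_pos hk, div_le_iff₀ hk]
    exact hwin' n
  have hclose := close_of_amplitude (hAdm' n) hmAdm hZm hPm hε (hδε n) hr1 hZc hPc
  -- `m` is a normalised maximiser at `ν_w = 3c/4`; `r • m` at `ν_w r`; `b⁻¹ r • m` at `ν_n`; then scale by `l⁻¹`
  have hνw : (0 : ℝ) < 3 * c / 4 := by positivity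
  have hmN := normalisedMaximiser_of_unit hc hmAdm hZm hPm hSm
  have hν1 : (0 : ℝ) < 3 * c / 4 * r := by positivity
  have hmr := normalisedMaximiser_const_smul hνw hν1 hmN
  have hdiv1 : 3 * c / 4 * r / (3 * c / 4) = r := by field_simp
  simp only [hdiv1] at hmr
  have hmb := normalisedMaximiser_const_smul hν1 (hν n) hmr
  have hdiv2 : ν n / (3 * c / 4 * r) = (B n / A n ^ 3)⁻¹ := by
    rw [hr]
    simp only [hκ]
    have hB0 : B n ≠ 0 := (hBpos n).ne'
    have hA0 : A n ≠ 0 := (hApos n).ne'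
    have hν0 : ν n ≠ 0 := (hν n).ne'
    field_simp
  simp only [hdiv2] at hmb
  have hmn := normalisedMaximiser_scale hmb (inv_pos.2 (hlpos n))
  -- transport the closeness back to `v n`
  have hback := transport_close (m' := fun y => r • m y) (hAdm n).1 (hmAdm.1.const_smul r) (hlpos n) (hbpos n)
    (hZ' n) (hP' n) hclose.1 hclose.2
  -- contradiction with the choice of `v n`
  have h1 := hbad n (fun x => (A n ^ 2 / B n ^ 2)⁻¹ • ((B n / A n ^ 3)⁻¹ • (r • m ((A n ^ 2 / B n ^ 2)⁻¹ • x))))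
    (by simpa only using hmn) (by simpa only using hback.1)
  exact absurd (by simpa only using hback.2) (not_le.2 h1)

/-- **`NearSaturationNearMaximiser` (stmt-25482) from the sequential core, BY NAME.** If for the sharp one-sided Lu–Doering
constant `c⋆` (the item's sharp-constant clause, verbatim) every sequence of admissible fields normalised to `Z = Pal = 1` with
stretching `S → c⋆` has, for every `ε > 0`, a term `ε`-close in `Ḣ¹ ∩ Ḣ²` to an admissible field with `Z = Pal = 1`, `S = c⋆`
(an exact normalised maximiser), then the route decl `Theses.EfficiencyFloor.NearSaturationNearMaximiser` holds
(`shape_of_seqCore` + `nearSaturationNearMaximiser_iff_shape`, p819457/Shape). The hypothesis is what a concentration-compactness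
argument for the scale-invariant functional `S/(Z^{3/4}Pal^{3/4})` on `ℝ³` delivers (precompactness of normalised maximising
sequences modulo translations + continuity of `Z, Pal, S`); it is NOT proved here. [folklore] -/
theorem nearSaturationNearMaximiser_of_seqCore
    (H : ∀ c : ℝ, (0 < c ∧ (∀ v : EuclideanSpace ℝ (Fin 3) → EuclideanSpace ℝ (Fin 3), (ContDiff ℝ (⊤ : ℕ∞) v ∧
      Literature.Analysis.FluidPDE.VectorCalculus.IsDivFree v ∧ (∫⁻ x, ‖iteratedFDeriv ℝ 0 v x‖ₑ ^ 2 < ⊤) ∧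
      (∫⁻ x, ‖iteratedFDeriv ℝ 1 v x‖ₑ ^ 2 < ⊤) ∧ (∫⁻ x, ‖iteratedFDeriv ℝ 2 v x‖ₑ ^ 2 < ⊤)) → (∫ x,
      ⟪Literature.Analysis.FluidPDE.curl v x, fderiv ℝ v x (Literature.Analysis.FluidPDE.curl v x)⟫_ℝ) ≤ c *
      (∫ x, ‖Literature.Analysis.FluidPDE.curl v x‖ ^ 2) ^ (3 / 4 : ℝ) * (∫ x,
      Literature.Analysis.FluidPDE.frobeniusNormSq (fderiv ℝ (Literature.Analysis.FluidPDE.curl v) x)) ^ (3 /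
      4 : ℝ)) ∧ ∀ c' : ℝ, (∀ w : EuclideanSpace ℝ (Fin 3) → EuclideanSpace ℝ (Fin 3), (ContDiff ℝ (⊤ : ℕ∞) w ∧
      Literature.Analysis.FluidPDE.VectorCalculus.IsDivFree w ∧ (∫⁻ x, ‖iteratedFDeriv ℝ 0 w x‖ₑ ^ 2 < ⊤) ∧
      (∫⁻ x, ‖iteratedFDeriv ℝ 1 w x‖ₑ ^ 2 < ⊤) ∧ (∫⁻ x, ‖iteratedFDeriv ℝ 2 w x‖ₑ ^ 2 < ⊤)) → (∫ x,
      ⟪Literature.Analysis.FluidPDE.curl w x, fderiv ℝ w x (Literature.Analysis.FluidPDE.curl w x)⟫_ℝ) ≤ c' *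
      (∫ x, ‖Literature.Analysis.FluidPDE.curl w x‖ ^ 2) ^ (3 / 4 : ℝ) * (∫ x,
      Literature.Analysis.FluidPDE.frobeniusNormSq (fderiv ℝ (Literature.Analysis.FluidPDE.curl w) x)) ^ (3 /
      4 : ℝ)) → c ≤ c') →
      ∀ v : ℕ → EuclideanSpace ℝ (Fin 3) → EuclideanSpace ℝ (Fin 3), (∀ n, ContDiff ℝ (⊤ : ℕ∞) (v n) ∧
      Literature.Analysis.FluidPDE.VectorCalculus.IsDivFree (v n) ∧ (∫⁻ x, ‖iteratedFDeriv ℝ 0 (v n) x‖ₑ ^ 2 < ⊤) ∧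
      (∫⁻ x, ‖iteratedFDeriv ℝ 1 (v n) x‖ₑ ^ 2 < ⊤) ∧ (∫⁻ x, ‖iteratedFDeriv ℝ 2 (v n) x‖ₑ ^ 2 < ⊤)) →
      (∀ n, (∫ x, ‖Literature.Analysis.FluidPDE.curl (v n) x‖ ^ 2) = 1) →
      (∀ n, (∫ x, Literature.Analysis.FluidPDE.frobeniusNormSq (fderiv ℝ (Literature.Analysis.FluidPDE.curl (v n)) x)) = 1) →
      Tendsto (fun n => ∫ x, ⟪Literature.Analysis.FluidPDE.curl (v n) x, fderiv ℝ (v n) x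
        (Literature.Analysis.FluidPDE.curl (v n) x)⟫_ℝ) atTop (𝓝 c) →
      ∀ ε : ℝ, 0 < ε → ∃ n : ℕ, ∃ m : EuclideanSpace ℝ (Fin 3) → EuclideanSpace ℝ (Fin 3), (ContDiff ℝ (⊤ : ℕ∞) m ∧
        Literature.Analysis.FluidPDE.VectorCalculus.IsDivFree m ∧ (∫⁻ x, ‖iteratedFDeriv ℝ 0 m x‖ₑ ^ 2 < ⊤) ∧
        (∫⁻ x, ‖iteratedFDeriv ℝ 1 m x‖ₑ ^ 2 < ⊤) ∧ (∫⁻ x, ‖iteratedFDeriv ℝ 2 m x‖ₑ ^ 2 < ⊤)) ∧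
        (∫ x, ‖Literature.Analysis.FluidPDE.curl m x‖ ^ 2) = 1 ∧
        (∫ x, Literature.Analysis.FluidPDE.frobeniusNormSq (fderiv ℝ (Literature.Analysis.FluidPDE.curl m) x)) = 1 ∧
        (∫ x, ⟪Literature.Analysis.FluidPDE.curl m x, fderiv ℝ m x (Literature.Analysis.FluidPDE.curl m x)⟫_ℝ) = c ∧
        (∫ x, ‖Literature.Analysis.FluidPDE.curl (v n - m) x‖ ^ 2) ≤ ε ^ 2 ∧
        (∫ x, Literature.Analysis.FluidPDE.frobeniusNormSq (fderiv ℝ (Literature.Analysis.FluidPDE.curl (v n - m)) x)) ≤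
          ε ^ 2) :
    Summit.NavierStokesRegularity.NavierStokesRegularity.Theses.EfficiencyFloor.NearSaturationNearMaximiser :=
  nearSaturationNearMaximiser_iff_shape.2 fun c _ hsharp hε => shape_of_seqCore hsharp.1 hsharp.2.1 (H c hsharp) hε

end SeqCore

end NearSaturationNearMaximiser

end Summit.NavierStokesRegularity.NavierStokesRegularity.Theorems

end
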